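import Summits.PneNP.PneNP.Theorems.BISOrderDimensionDimThreeToIdeals
import Literature.Computability.Complexity.PRelHierarchy
import Literature.Computability.Complexity.PromiseProofs
import Literature.Computability.Complexity.Counting
import Literature.Computability.Complexity.CodeFPStrings

/-!
# Route BISOrderDimension — the ideal-indicator verifier (helper for `Assembly`, stmt-PneNP-2098)

The witness relation of `#IDEALS`: `⟨x, y⟩ ∈ R` iff `x` decodes to an `n × n` matrix `M` (header `n`, entry list of length
`n²`), `|y| = n`, and `y` is the indicator vector of an implication-closed set (`y_i ∧ M i j ≠ 0 → y_j`). One typed `CodeFP`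
program decides it (`bisOrderDimension_exists_idealRel`: a language `R ∈ P` with exactly this membership), and for a
decoding `x` its witnesses of length `n` are in bijection with the ideals counted by the route (`bisOrderDimension_countWitnesses_eq`).
-/

set_option linter.dupNamespace false -- `Summit.PneNP.PneNP.…`: summit = sub-problem name (D-0017 single-conjunct layout)

namespace Summit.PneNP.PneNP.Theorems

open _root_.Computability Polynomial
open Literature.Computability.Complexity Literature.Computability.Complexity.CodeFP
  Literature.Computability.Complexity.Brick

/-- **The typed ideal-indicator test** on `(x, y)`. [cite: AroraBarakCC2009, §1.3] [folklore] -/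
theorem bisOrderDimension_idealTest_codeFP :
    CodeFP (pairE strE strE) bitE fun t : List Bool × List Bool =>
      decide ((NegCNF.decList decodeNat (boolUnpair (sndF t.1)).1.length (boolUnpair (sndF t.1)).2).length =
          decodeNat (fstF t.1) * decodeNat (fstF t.1)) &&
        (decide (t.2.length = decodeNat (fstF t.1)) &&
          (List.range (min (decodeNat (fstF t.1)) t.1.length)).all fun i =>
            (List.range (min (decodeNat (fstF t.1)) t.1.length)).all fun j =>
              !(t.2.getD i false) ||
                (decide ((NegCNF.decList decodeNat (boolUnpair (sndF t.1)).1.length (boolUnpair (sndF t.1)).2).getD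
                    (i * decodeNat (fstF t.1) + j) 0 = 0) || t.2.getD j false)) := by
  have hfst : CodeFP strE strE fun w : List Bool => fstF w := CodeFP.of_fn fstF fstF_mem_FP fun _ => rfl
  have hsnd : CodeFP strE strE fun w : List Bool => sndF w := CodeFP.of_fn sndF sndF_mem_FP fun _ => rfl
  have hdec : CodeFP strE natE fun w : List Bool => decodeNat w := CodeFP.of_fn canonF canonF_mem_FP canonF_eq_encodeNat_decodeNat
  have hlistC : CodeFP strE (listE natE) fun c : List Bool => NegCNF.decList decodeNat (boolUnpair c).1.length (boolUnpair c).2 :=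
    CodeFP.of_fn (CanonCode.canonListFnC 2 canonF) (CanonCode.canonListFnC_mem_FP 2 canonF_mem_FP) fun c =>
      (bisOrderDimension_listDecode c).2.trans (congrFun (listE_eq encodingNatBool) _)
  have hx : CodeFP (pairE strE strE) strE fun t : List Bool × List Bool => t.1 := CodeFP.fst _ _
  have hy : CodeFP (pairE strE strE) strE fun t : List Bool × List Bool => t.2 := CodeFP.snd _ _
  have hn : CodeFP (pairE strE strE) natE fun t : List Bool × List Bool => decodeNat (fstF t.1) := (hdec.comp (hfst.comp hx) :)
  have hL : CodeFP (pairE strE strE) (rawE natE) fun t : List Bool × List Bool =>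
      NegCNF.decList decodeNat (boolUnpair (sndF t.1)).1.length (boolUnpair (sndF t.1)).2 :=
    ((rawOfList natE).comp (hlistC.comp (hsnd.comp hx)) :)
  have hlenL := ((natLength natE).comp hL :)
  have hnn := (natMul.comp (hn.pair hn) :)
  have h1 : CodeFP (pairE strE strE) bitE fun t : List Bool × List Bool =>
      decide ((NegCNF.decList decodeNat (boolUnpair (sndF t.1)).1.length (boolUnpair (sndF t.1)).2).length =
        decodeNat (fstF t.1) * decodeNat (fstF t.1)) := (natEq.comp (hlenL.pair hnn) :)
  have h2 : CodeFP (pairE strE strE) bitE fun t : List Bool × List Bool => decide (t.2.length = decodeNat (fstF t.1)) :=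
    (natEq.comp ((natOfUn.comp (strLength.comp hy)).pair hn) :)
  have hR : CodeFP (pairE strE strE) (rawE natE) fun t : List Bool × List Bool => List.range (min (decodeNat (fstF t.1)) t.1.length) :=
    (rangeOf.comp ((strLength.comp hx).pair hn) :)
  -- inner predicate on `(((((L, y), n), R), i), j)`
  have qL : CodeFP (pairE (pairE (pairE (pairE (pairE (rawE natE) strE) natE) (rawE natE)) natE) natE) (rawE natE)
      fun q : ((((List ℕ × List Bool) × ℕ) × List ℕ) × ℕ) × ℕ => q.1.1.1.1.1 := (CodeFP.fst _ _).fst'.fst'.fst'.fst'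
  have qy : CodeFP (pairE (pairE (pairE (pairE (pairE (rawE natE) strE) natE) (rawE natE)) natE) natE) strE
      fun q : ((((List ℕ × List Bool) × ℕ) × List ℕ) × ℕ) × ℕ => q.1.1.1.1.2 := (CodeFP.fst _ _).fst'.fst'.fst'.snd'
  have qn : CodeFP (pairE (pairE (pairE (pairE (pairE (rawE natE) strE) natE) (rawE natE)) natE) natE) natE
      fun q : ((((List ℕ × List Bool) × ℕ) × List ℕ) × ℕ) × ℕ => q.1.1.1.2 := (CodeFP.fst _ _).fst'.fst'.snd'
  have qi : CodeFP (pairE (pairE (pairE (pairE (pairE (rawE natE) strE) natE) (rawE natE)) natE) natE) natE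
      fun q : ((((List ℕ × List Bool) × ℕ) × List ℕ) × ℕ) × ℕ => q.1.2 := (CodeFP.fst _ _).snd'
  have qj : CodeFP (pairE (pairE (pairE (pairE (pairE (rawE natE) strE) natE) (rawE natE)) natE) natE) natE
      fun q : ((((List ℕ × List Bool) × ℕ) × List ℕ) × ℕ) × ℕ => q.2 := CodeFP.snd _ _
  have hget : CodeFP (pairE (rawE natE) natE) natE fun p : List ℕ × ℕ => p.1.getD p.2 0 := rawGetD natE rfl
  have hbi := (strGetDNat.comp (qy.pair qi) :)
  have hbj := (strGetDNat.comp (qy.pair qj) :)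
  have hent := (hget.comp (qL.pair (natAdd.comp ((natMul.comp (qi.pair qn)).pair qj))) :)
  have hzero := (natEq.comp (hent.pair (CodeFP.const _ 0)) :)
  have hP2 : CodeFP (pairE (pairE (pairE (pairE (pairE (rawE natE) strE) natE) (rawE natE)) natE) natE) bitE
      fun q : ((((List ℕ × List Bool) × ℕ) × List ℕ) × ℕ) × ℕ =>
        !(q.1.1.1.1.2.getD q.1.2 false) || (decide (q.1.1.1.1.1.getD (q.1.2 * q.1.1.1.2 + q.2) 0 = 0) || q.1.1.1.1.2.getD q.2 false) :=
    hbi.not.or (hzero.or hbj)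
  -- middle predicate on `((((L, y), n), R), i)`: all `j ∈ R`
  have hRi : CodeFP (pairE (pairE (pairE (pairE (rawE natE) strE) natE) (rawE natE)) natE) (rawE natE)
      fun q : (((List ℕ × List Bool) × ℕ) × List ℕ) × ℕ => q.1.2 := (CodeFP.fst _ _).snd'
  have hP1 := ((CodeFP.all hP2).comp ((CodeFP.id _).pair hRi) :)
  -- outer: all `i ∈ R`
  have hall := ((CodeFP.all hP1).comp (((((hL.pair hy).pair hn).pair hR)).pair hR) :)
  exact h1.and (h2.and hall)

/-- **The ideal-indicator relation is in `P`**, with its membership on pairs. [cite: AroraBarakCC2009, Def. 1.13] [folklore] -/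
theorem bisOrderDimension_exists_idealRel :
    ∃ R : Language Bool, R ∈ Classes.P ∧ ∀ x y : List Bool, boolPair x y ∈ R ↔
      ((NegCNF.decList decodeNat (boolUnpair (sndF x)).1.length (boolUnpair (sndF x)).2).length = decodeNat (fstF x) * decodeNat (fstF x) ∧
        y.length = decodeNat (fstF x) ∧
        ∀ i, i < min (decodeNat (fstF x)) x.length → ∀ j, j < min (decodeNat (fstF x)) x.length →
          y.getD i false = true → (NegCNF.decList decodeNat (boolUnpair (sndF x)).1.length (boolUnpair (sndF x)).2).getD
            (i * decodeNat (fstF x) + j) 0 ≠ 0 → y.getD j false = true) := by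
  obtain ⟨g, hg, hgspec⟩ := bisOrderDimension_idealTest_codeFP
  refine ⟨g ⁻¹' PRelSigma.HeadIs true, preimage_mem_P (PRelSigma.HeadIs_mem_P true) hg, fun x y => ?_⟩
  change (g (pairE strE strE (x, y))).head? = some true ↔ _
  rw [hgspec]
  simp only [bitE, List.head?_cons, Option.some.injEq, Bool.and_eq_true, decide_eq_true_eq, List.all_eq_true, List.mem_range,
    Bool.or_eq_true, Bool.not_eq_true']
  refine and_congr_right fun _ => and_congr_right fun _ => forall₂_congr fun i _ => forall₂_congr fun j _ => ?_
  constructor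
  · rintro (h | h | h) hyi hM
    · rw [hyi] at h; exact absurd h Bool.noConfusion
    · exact absurd h hM
    · exact h
  · intro h
    by_cases hyi : y.getD i false = true
    · by_cases hM : (NegCNF.decList decodeNat (boolUnpair (sndF x)).1.length (boolUnpair (sndF x)).2).getD (i * decodeNat (fstF x) + j) 0 = 0
      · exact Or.inr (Or.inl hM)
      · exact Or.inr (Or.inr (h hyi hM))
    · exact Or.inl (by simpa using hyi)

/-- **Witnesses of length `n` are the ideals.** For a decoding `x` (entry list of length `n²`), the number of `y ∈ {0,1}ⁿ` with
`⟨x, y⟩ ∈ R` is the number of implication-closed subsets of the matrix read off `x`. [folklore] -/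
theorem bisOrderDimension_countWitnesses_eq (R : Language Bool)
    (hR : ∀ x y : List Bool, boolPair x y ∈ R ↔
      ((NegCNF.decList decodeNat (boolUnpair (sndF x)).1.length (boolUnpair (sndF x)).2).length = decodeNat (fstF x) * decodeNat (fstF x) ∧
        y.length = decodeNat (fstF x) ∧
        ∀ i, i < min (decodeNat (fstF x)) x.length → ∀ j, j < min (decodeNat (fstF x)) x.length →
          y.getD i false = true → (NegCNF.decList decodeNat (boolUnpair (sndF x)).1.length (boolUnpair (sndF x)).2).getD
            (i * decodeNat (fstF x) + j) 0 ≠ 0 → y.getD j false = true))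
    (x : List Bool)
    (hdec : (NegCNF.decList decodeNat (boolUnpair (sndF x)).1.length (boolUnpair (sndF x)).2).length = decodeNat (fstF x) * decodeNat (fstF x))
    (hmin : min (decodeNat (fstF x)) x.length = decodeNat (fstF x)) :
    countWitnesses R (decodeNat (fstF x)) x =
      Set.ncard {I : Finset (Fin (decodeNat (fstF x))) | ∀ i ∈ I, ∀ j : Fin (decodeNat (fstF x)),
        (NegCNF.decList decodeNat (boolUnpair (sndF x)).1.length (boolUnpair (sndF x)).2).getD (i * decodeNat (fstF x) + j) 0 ≠ 0 → j ∈ I} := by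
  classical
  set n := decodeNat (fstF x) with hn
  set L := NegCNF.decList decodeNat (boolUnpair (sndF x)).1.length (boolUnpair (sndF x)).2 with hL
  -- both sides as cardinalities of filtered finite sets
  have hget : ∀ (y : List.Vector Bool n) (i : Fin n), y.toList.getD i false = y.get i := by
    intro y i
    rw [List.getD_eq_getElem _ _ (by simp), List.Vector.get_eq_get_toList]
    rfl
  have hmem : ∀ y : List.Vector Bool n, boolPair x y.toList ∈ R ↔
      ∀ i j : Fin n, y.get i = true → L.getD (i * n + j) 0 ≠ 0 → y.get j = true := by
    intro y
    rw [hR, hmin]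
    constructor
    · rintro ⟨-, -, h⟩ i j hi hM
      have h' := h i i.isLt j j.isLt (by rw [hget]; exact hi) hM
      rwa [hget] at h'
    · intro h
      refine ⟨hdec, y.toList_length, fun i hi j hj hyi hM => ?_⟩
      have hyi' : y.get ⟨i, hi⟩ = true := by rw [← hget]; exact hyi
      have h' := h ⟨i, hi⟩ ⟨j, hj⟩ hyi' hM
      rw [← hget] at h'
      exact h'
  have hset : {I : Finset (Fin n) | ∀ i ∈ I, ∀ j : Fin n, L.getD (i * n + j) 0 ≠ 0 → j ∈ I} =
      ((Finset.univ.filter fun I : Finset (Fin n) => ∀ i ∈ I, ∀ j : Fin n, L.getD (i * n + j) 0 ≠ 0 → j ∈ I : Finset (Finset (Fin n))) : Set _) := by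
    ext I; simp
  rw [hset, Set.ncard_coe_finset]
  unfold countWitnesses
  refine Finset.card_bij (fun y _ => Finset.univ.filter fun i : Fin n => y.get i = true) (fun y hy => ?_) (fun y₁ hy₁ y₂ hy₂ h => ?_)
    (fun I hI => ?_)
  · rw [Finset.mem_filter] at hy ⊢
    refine ⟨Finset.mem_univ _, fun i hi j hM => ?_⟩
    rw [Finset.mem_filter] at hi ⊢
    exact ⟨Finset.mem_univ _, (hmem y).1 hy.2 i j hi.2 hM⟩
  · apply List.Vector.ext
    intro i
    have h' := Finset.ext_iff.1 h i
    simp only [Finset.mem_filter, Finset.mem_univ, true_and] at h'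
    exact Bool.eq_iff_iff.2 h'
  · refine ⟨List.Vector.ofFn fun i => decide (i ∈ I), ?_, ?_⟩
    · rw [Finset.mem_filter]
      refine ⟨Finset.mem_univ _, (hmem _).2 fun i j hi hM => ?_⟩
      rw [List.Vector.get_ofFn, decide_eq_true_eq] at hi ⊢
      rw [Finset.mem_filter] at hI
      exact hI.2 i hi j hM
    · ext i
      rw [Finset.mem_filter, List.Vector.get_ofFn, decide_eq_true_eq]
      simp

end Summit.PneNP.PneNP.Theorems
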